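import Mathlib
import Summits.KontsevichZagierPeriods.Zeta5Search.FlagRayDominance
import Summits.KontsevichZagierPeriods.Zeta5Search.MinorTermwiseBounds
import Summits.KontsevichZagierPeriods.Zeta5Search.BigPrimeWindow
import Summits.KontsevichZagierPeriods.Zeta5Search.ValuationLawsAboveB0
import HarnessLib

/-!
# ζ(5) search — (QV) and (P̂V) on the WHOLE band-60 FLAG ray, every direction `j`, all `n` (termwise class bounds + the flag covers + counting)

Cell `pub-zeta5` (HONEST FRAMING: systematic search; no irrationality claim unless certified), TRACK «DENOM-LAW» D1 prover seat
(denom-prover-d1 g12, `HOME/denom-law/prover-d1/ATTEMPT-12.md` §7).  Two of gen-2 g5's four OBSERVED valuation laws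
(`QMinorValuationLaw`: `v_p(U W⁺ − U⁺ W) ≥ refund − N_p`; `PhatMinorValuationLaw`: `v_p(U V⁺ − U⁺ V) ≥ refund − 1 − N_p`; theorems so far only
above `b₀`, `ValuationLawsAboveB0`) PROVED on the flag ray `b(n) = n·(60; 25,24,22,21,19,18,16)` for every `n ≥ 1`, every `1 ≤ j ≤ 7` and every
prime `p ≥ 5` with `p² > 60n + 2`, from the TERMWISE bounds of `MinorTermwiseBounds` (no `U`–`W`/`V` cancellation is needed on this ray):
* §2 `p > 13n`: the landed covers `FlagRayCellsA…H` / `StairCellFLAGa` cell by cell (`checkLB` data `(A,B) = (−7,−4) … (0,1)`, `N_p` from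
  `pairFloors_flag`): (QV) with slack ≥ 3 and (P̂V) with slack ≥ 0 (tight on `(23n,26n]`) — EXCEPT (QV) on `26n < p ≤ 35n` (`refund = 1`,
  `N_p = 0`: a genuine unit), which is the landed `W`-divisibility `BigPrime.one_le_padicValRat_coeffW_of_slots` (slots `16n ≤ 18n ≤ 19n`,
  `p ≥ 23n + 1`, `p ≤ d + 1`) for `b(n)` and for `b(n) + e_j` (`coeffW_small_of_flaglike`), times the `p`-integral `U`, `U⁺`;
* §3–§4 (file `FlagRayMinorsAll`) `p ≤ 13n`: counting — the interval certificate `flag_table` (`FlagRayDominanceLow`) on `250n < 35p`, whose margin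
  `L + min(0,3+L) ≥ refund − N_p` dominates both minor laws, and the tree's linear counts `mul_countBound_ge` / `mul_pairFloors_ge` on
  `35p ≤ 250n + 23` (`2L + N_p ≥ −5`, `L + N_p ≥ 1`, `N_p ≥ 1`);
  then `flagRayQV`, `flagRayPhatV` and the nodes restricted to the ray (binders verbatim, plus the window for (QV)).
Brute force (`g12/code/gap/minors_check.py`, n ≤ 4, every window prime, every j: 854 rows, 0 violations; (QV) attained in 476, (P̂V) in 147).
MODEL/structure-side valuation bookkeeping of the cell's own rationals; the ∀-b nodes stay OPEN; nothing about ζ(5); no γ; records UNMOVED.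
-/

open Finset

namespace Summit.KontsevichZagierPeriods.Zeta5Search.StairFLAG

open Summit.KontsevichZagierPeriods.Zeta5Search.ClusterValuation
open Summit.KontsevichZagierPeriods.Zeta5Search.CasoratianValuation (InPolytope shift casoratian pairFloors refund minorQ minorPhat)
open Summit.KontsevichZagierPeriods.Zeta5Search.WedgeDictionary (dOf coeffU coeffW coeffV)
open Summit.KontsevichZagierPeriods.Zeta5Search.DualSeries (InBox)
open Summit.KontsevichZagierPeriods.Zeta5Search.PadicSeries (one_le_p zpow_p_nonneg)
open Summit.KontsevichZagierPeriods.Zeta5Search.BigPrime (shift_zero dOf_shift)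
open Summit.KontsevichZagierPeriods.Zeta5Search.ClassTypeCover
open Summit.KontsevichZagierPeriods.Zeta5Search.StaircaseCells
open Summit.KontsevichZagierPeriods.Zeta5Search.CellA (classExp_le_classNu)
open Summit.KontsevichZagierPeriods.Zeta5Search.ClusterValuation.MinorBounds

variable {p : ℕ} [hp : Fact p.Prime]

/-! ## §2 The flag ray above `13n`, cell by cell -/

section Ray

variable {n j : ℕ} (hn : 1 ≤ n) (hj1 : 1 ≤ j) (hj7 : j ≤ 7) (hprime : p.Prime)
include hn hj1 hj7 hprime

omit hprime in
/-- The cover step with explicit termwise exponents `u ≤ min(0, B+2)`, `w ≤ min(0, B)` (numerals supplied by the caller). -/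
theorem cell_minors' {TY : List (List ℤ × Bool)} (h13 : 13 * n < p) (hcov : Cover (bRay [60, 25, 24, 22, 21, 19, 18, 16] n) p TY)
    {A B : ℤ} (hchk : ∀ odd, checkLB odd TY A B = true) (u w : ℤ) (hu0 : u ≤ 0) (huB : u ≤ B + 2) (hw0 : w ≤ 0) (hwB : w ≤ B) :
    (minorQ (bRay [60, 25, 24, 22, 21, 19, 18, 16] n) j ≠ 0 → u + w ≤ padicValRat p (minorQ (bRay [60, 25, 24, 22, 21, 19, 18, 16] n) j)) ∧
    (minorPhat (bRay [60, 25, 24, 22, 21, 19, 18, 16] n) j ≠ 0 → u + A ≤ padicValRat p (minorPhat (bRay [60, 25, 24, 22, 21, 19, 18, 16] n) j)) := by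
  obtain ⟨hp5, hwin⟩ := window13 hn h13
  obtain ⟨hA, hB⟩ := bounds_of_cover hcov (hchk _)
  exact minors_of_bounds _ (inPolytope_ray n) hj1 (inPolytope_shift_ray_j hn j hj1 hj7) hp5 hwin u w A hu0 hw0
    (fun x hx h2 => by have := hB x hx h2; omega) (fun x hx h2 => by have := hB x hx h2; omega) hA

omit hj1 hj7 in
/-- `p ∣ W(c)` for a FLAG-LIKE vector `c` (`c₀ = 60n`; `c₁,…,c₄ ≥ 21n`; `c₅ ∈ [19n, 19n+1]`; `c₆ ∈ [18n, 18n+1]`) at `23n + 1 ≤ p ≤ d(c) + 1`: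
the landed `W`-divisibility `BigPrime.one_le_padicValRat_coeffW_of_slots` on the slots `c₇ ≤ c₆ ≤ c₅`. -/
theorem coeffW_small_of_flaglike (c : ℕ → ℤ) (hc : InPolytope c) (h0 : c 0 = 60 * n)
    (h5 : 19 * (n : ℤ) ≤ c 5 ∧ c 5 ≤ 19 * n + 1) (h6 : 18 * (n : ℤ) ≤ c 6 ∧ c 6 ≤ 18 * n + 1)
    (hbig : ∀ i ∈ range 4, 21 * (n : ℤ) ≤ c (i + 1)) (hp23 : 23 * n + 1 ≤ p) (hpd : (p : ℤ) ≤ dOf c + 1) :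
    padicNorm p (coeffW c) ≤ (p : ℚ) ^ (-(1 : ℤ)) := by
  refine padicNorm_le_of_val fun hW => ?_
  have hn1 : (1 : ℤ) ≤ n := by exact_mod_cast hn
  have hp' : (23 * n + 1 : ℤ) ≤ p := by exact_mod_cast hp23
  refine BigPrime.one_le_padicValRat_coeffW_of_slots c p 6 5 4 hc.1 hc.2.1 hc.2.2 (by simp) (by simp) (by simp) (by norm_num)
    (by linarith [h5.1, h6.2]) (fun k hk hk6 hk5 => ?_) hprime (by omega) (by rw [h0]; linarith [h5.1, h6.1]) hpd hW
  simp only [mem_range] at hk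
  have hb0 := hbig 0 (by simp); have hb1 := hbig 1 (by simp); have hb2 := hbig 2 (by simp); have hb3 := hbig 3 (by simp)
  simp only [Nat.reduceAdd] at hb0 hb1 hb2 hb3
  interval_cases k
  · linarith [h5.2]
  · linarith [h5.2]
  · linarith [h5.2]
  · linarith [h5.2]
  · exact le_rfl
  · exact absurd rfl hk5
  · exact absurd rfl hk6

omit hn hj1 hj7 hprime in
/-- The flag ray is flag-like. -/
theorem flaglike_ray : ((bRay [60, 25, 24, 22, 21, 19, 18, 16] n) 0 = 60 * n) ∧
    (19 * (n : ℤ) ≤ (bRay [60, 25, 24, 22, 21, 19, 18, 16] n) 5 ∧ (bRay [60, 25, 24, 22, 21, 19, 18, 16] n) 5 ≤ 19 * n + 1) ∧ (18 * (n : ℤ) ≤ (bRay [60, 25, 24, 22, 21, 19, 18, 16] n) 6 ∧ (bRay [60, 25, 24, 22, 21, 19, 18, 16] n) 6 ≤ 18 * n + 1) ∧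
    (∀ i ∈ range 4, 21 * (n : ℤ) ≤ (bRay [60, 25, 24, 22, 21, 19, 18, 16] n) (i + 1)) := by
  refine ⟨by rw [v0]; push_cast; ring, by rw [v5]; push_cast; constructor <;> linarith,
    by rw [v6]; push_cast; constructor <;> linarith, fun i hi => ?_⟩
  simp only [mem_range] at hi
  interval_cases i <;> simp only [Nat.reduceAdd, v1, v2, v3, v4] <;> push_cast <;> linarith

omit hn hprime in
/-- Every contiguous shift of the flag ray is flag-like. -/
theorem flaglike_shift : ((shift (bRay [60, 25, 24, 22, 21, 19, 18, 16] n) j) 0 = 60 * n) ∧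
    (19 * (n : ℤ) ≤ (shift (bRay [60, 25, 24, 22, 21, 19, 18, 16] n) j) 5 ∧ (shift (bRay [60, 25, 24, 22, 21, 19, 18, 16] n) j) 5 ≤ 19 * n + 1) ∧
    (18 * (n : ℤ) ≤ (shift (bRay [60, 25, 24, 22, 21, 19, 18, 16] n) j) 6 ∧ (shift (bRay [60, 25, 24, 22, 21, 19, 18, 16] n) j) 6 ≤ 18 * n + 1) ∧
    (∀ i ∈ range 4, 21 * (n : ℤ) ≤ (shift (bRay [60, 25, 24, 22, 21, 19, 18, 16] n) j) (i + 1)) := by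
  have hs : ∀ i, shift (bRay [60, 25, 24, 22, 21, 19, 18, 16] n) j i = if i = j then bRay [60, 25, 24, 22, 21, 19, 18, 16] n j + 1 else bRay [60, 25, 24, 22, 21, 19, 18, 16] n i := by
    intro i; simp only [shift, Function.update_apply]
  interval_cases j <;>
  · refine ⟨?_, ?_, ?_, fun i hi => ?_⟩
    · rw [hs]; simp only [Nat.reduceEqDiff, if_false, v0]; push_cast; ring
    · simp only [hs, Nat.reduceEqDiff, if_true, if_false, v5]; push_cast; constructor <;> linarith
    · simp only [hs, Nat.reduceEqDiff, if_true, if_false, v6]; push_cast; constructor <;> linarith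
    · simp only [mem_range] at hi
      interval_cases i <;> simp only [hs, Nat.reduceAdd, Nat.reduceEqDiff, if_true, if_false, v1, v2, v3, v4] <;> push_cast <;> linarith

/-- **(QV) needs a unit on `26n < p ≤ 35n`** (`refund = 1`, `N_p = 0`): there `p ∣ W(b(n))` and `p ∣ W(b(n)+e_j)` (`coeffW_small_of_flaglike`;
`p ≥ 23n + 1`, `p ≤ d + 1` resp. `≤ d(b⁺) + 1 = 35n`), and `U`, `U⁺` are `p`-integral (every multipole class has `5 + E ≥ 0`). -/
theorem minorQ_c26 (hA : 26 * n < p) (hB : p ≤ 35 * n) (hne : minorQ (bRay [60, 25, 24, 22, 21, 19, 18, 16] n) j ≠ 0) :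
    (1 : ℤ) ≤ padicValRat p (minorQ (bRay [60, 25, 24, 22, 21, 19, 18, 16] n) j) := by
  obtain ⟨hp5, hwin⟩ := window13 hn (by omega : 13 * n < p)
  have hp2 : p % 2 = 1 := Nat.odd_iff.1 (hprime.odd_of_ne_two (by omega))
  have hb : InPolytope (bRay [60, 25, 24, 22, 21, 19, 18, 16] n) := inPolytope_ray n
  have hb' : InPolytope (shift (bRay [60, 25, 24, 22, 21, 19, 18, 16] n) j) := inPolytope_shift_ray_j hn j hj1 hj7
  have h0' : shift (bRay [60, 25, 24, 22, 21, 19, 18, 16] n) j 0 = bRay [60, 25, 24, 22, 21, 19, 18, 16] n 0 := shift_zero _ hj1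
  have hwin' : (shift (bRay [60, 25, 24, 22, 21, 19, 18, 16] n) j 0 + 2 : ℤ) < (p : ℤ) ^ 2 := by rw [h0']; exact hwin
  obtain ⟨-, hBm⟩ := bounds_of_cover (cover_c26 (n := n) (p := p) (by omega) (by omega) hp2) (checkM_c26 _)
  have hum : ∀ x, x < p → 2 ≤ classPoleCount (bRay [60, 25, 24, 22, 21, 19, 18, 16] n) p x → (0 : ℤ) ≤ 5 + classExp (bRay [60, 25, 24, 22, 21, 19, 18, 16] n) p x :=
    fun x hx h2 => by have := hBm x hx h2; omega
  have hcnt : ∀ x, classPoleCount (shift (bRay [60, 25, 24, 22, 21, 19, 18, 16] n) j) p x ≤ classPoleCount (bRay [60, 25, 24, 22, 21, 19, 18, 16] n) p x :=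
    fun x => classPoleCount_shift_le _ hb.1 hj1 p x
  have hum' : ∀ x, x < p → 2 ≤ classPoleCount (shift (bRay [60, 25, 24, 22, 21, 19, 18, 16] n) j) p x → (0 : ℤ) ≤ 5 + classExp (shift (bRay [60, 25, 24, 22, 21, 19, 18, 16] n) j) p x :=
    fun x hx h2 => (hum x hx (le_trans h2 (hcnt x))).trans (by linarith [classExp_shift_ge _ hb.1 hj1 p x])
  have hU := coeffU_norm_le _ hb hp5 hwin 0 le_rfl hum
  have hU' := coeffU_norm_le _ hb' hp5 hwin' 0 le_rfl hum'
  obtain ⟨g0, g5, g6, gbig⟩ := flaglike_ray (n := n)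
  obtain ⟨s0, s5, s6, sbig⟩ := flaglike_shift (n := n) (j := j) hj1 hj7
  have hW := coeffW_small_of_flaglike (p := p) hn hprime _ hb g0 g5 g6 gbig (by omega) (by rw [dOf_ray]; push_cast; omega)
  have hW' := coeffW_small_of_flaglike (p := p) hn hprime _ hb' s0 s5 s6 sbig (by omega)
    (by rw [dOf_shift _ hj1 hj7, dOf_ray]; push_cast; omega)
  apply val_ge_of_padicNorm_le hne
  rw [minorQ, show (-(1 : ℤ)) = -((0 : ℤ) + 1) by norm_num]
  exact minor_norm_le hU hU' hW hW'

/-- **(QV) and (P̂V) at every prime `p > 13n`**, cell by cell (the `(A, B)` data of the landed covers). -/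
theorem minors_gt13 (h13 : 13 * n < p) :
    (minorQ (bRay [60, 25, 24, 22, 21, 19, 18, 16] n) j ≠ 0 →
      refund (bRay [60, 25, 24, 22, 21, 19, 18, 16] n) p - pairFloors (bRay [60, 25, 24, 22, 21, 19, 18, 16] n) p ≤ padicValRat p (minorQ (bRay [60, 25, 24, 22, 21, 19, 18, 16] n) j)) ∧
    (minorPhat (bRay [60, 25, 24, 22, 21, 19, 18, 16] n) j ≠ 0 →
      refund (bRay [60, 25, 24, 22, 21, 19, 18, 16] n) p - 1 - pairFloors (bRay [60, 25, 24, 22, 21, 19, 18, 16] n) p ≤ padicValRat p (minorPhat (bRay [60, 25, 24, 22, 21, 19, 18, 16] n) j)) := by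
  have hp0 : 0 < p := hprime.pos
  have hp2 := odd_of_prime_gt hprime h13 hn
  obtain ⟨hp5, hwin⟩ := window13 hn h13
  by_cases h60 : 60 * n < p
  · have hpb : (bRay [60, 25, 24, 22, 21, 19, 18, 16] n) 0 + 1 ≤ (p : ℤ) := by rw [v0]; push_cast; omega
    exact ⟨fun hne => BigPrime.qMinorValuationLaw_above _ j p (inPolytope_ray n) hj1 hj7 (inPolytope_shift_ray_j hn j hj1 hj7) hprime hp5 hpb hne,
      fun hne => BigPrime.phatMinorValuationLaw_above _ j p (inPolytope_ray n) hj1 (inPolytope_shift_ray_j hn j hj1 hj7) hprime hpb hne⟩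
  by_cases h35 : 35 * n < p
  · rw [refund_ray_zero h35, N_c35 (by omega)]
    have hc := cell_minors' hn hj1 hj7 h13 (cover_c35 (by omega) (by omega) hp2) checkM_c35 0 0 le_rfl (by norm_num) le_rfl le_rfl
    exact ⟨fun hne => by linarith [hc.1 hne], fun hne => by linarith [hc.2 hne]⟩
  push Not at h35
  rw [refund_ray_one hp0 h35]
  by_cases h : 2 * p ≤ 28 * n
  · rw [N_c13 (by omega) h]
    have hc := cell_minors' hn hj1 hj7 h13 (cover_c13 (by omega) h hp2) checkM_c13 (-2) (-4) (by norm_num) (by norm_num) (by norm_num) le_rfl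
    exact ⟨fun hne => by linarith [hc.1 hne], fun hne => by linarith [hc.2 hne]⟩
  by_cases h' : 2 * p ≤ 30 * n
  · rw [N_c14 (by omega) h']
    have hc := cell_minors' hn hj1 hj7 h13 (cover_c14 (by omega) h' hp2) checkM_c14 (-1) (-3) (by norm_num) (by norm_num) (by norm_num) le_rfl
    exact ⟨fun hne => by linarith [hc.1 hne], fun hne => by linarith [hc.2 hne]⟩
  by_cases h : 2 * p ≤ 32 * n
  · rw [N_c15 (by omega) h]
    have hc := cell_minors' hn hj1 hj7 h13 (cover_c15 (by omega) h hp2) checkM_c15 (-1) (-3) (by norm_num) (by norm_num) (by norm_num) le_rfl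
    exact ⟨fun hne => by linarith [hc.1 hne], fun hne => by linarith [hc.2 hne]⟩
  by_cases h' : 2 * p ≤ 34 * n
  · rw [N_c16 (by omega) h']
    have hc := cell_minors' hn hj1 hj7 h13 (cover_c16 (by omega) h' hp2) checkM_c16 0 (-2) le_rfl (by norm_num) (by norm_num) le_rfl
    exact ⟨fun hne => by linarith [hc.1 hne], fun hne => by linarith [hc.2 hne]⟩
  by_cases h : 2 * p ≤ 35 * n
  · rw [N_c17a (by omega) h]
    have hc := cell_minors' hn hj1 hj7 h13 (cover_c17a (by omega) h hp2) checkM_c17a 0 (-1) le_rfl (by norm_num) (by norm_num) le_rfl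
    exact ⟨fun hne => by linarith [hc.1 hne], fun hne => by linarith [hc.2 hne]⟩
  by_cases h' : 2 * p ≤ 36 * n
  · rw [N_c17b (by omega) h']
    have hc := cell_minors' hn hj1 hj7 h13 (cover_c17b (by omega) h' hp2) checkM_c17b 0 (-1) le_rfl (by norm_num) (by norm_num) le_rfl
    exact ⟨fun hne => by linarith [hc.1 hne], fun hne => by linarith [hc.2 hne]⟩
  by_cases h : 2 * p ≤ 38 * n
  · rw [N_c18 (by omega) h]
    have hc := cell_minors' hn hj1 hj7 h13 (cover_c18 (by omega) h hp2) checkM_c18 0 (-1) le_rfl (by norm_num) (by norm_num) le_rfl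
    exact ⟨fun hne => by linarith [hc.1 hne], fun hne => by linarith [hc.2 hne]⟩
  by_cases h' : 2 * p ≤ 40 * n
  · rw [N_c19 (by omega) h']
    have hc := cell_minors' hn hj1 hj7 h13 (cover_c19 (by omega) h' hp2) checkM_c19 0 (-1) le_rfl (by norm_num) (by norm_num) le_rfl
    exact ⟨fun hne => by linarith [hc.1 hne], fun hne => by linarith [hc.2 hne]⟩
  by_cases h : 2 * p ≤ 42 * n
  · rw [N_c20 (by omega) h]
    have hc := cell_minors' hn hj1 hj7 h13 (cover_c20 (by omega) h hp2) checkM_c20 0 (-1) le_rfl (by norm_num) (by norm_num) le_rfl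
    exact ⟨fun hne => by linarith [hc.1 hne], fun hne => by linarith [hc.2 hne]⟩
  by_cases hb22 : p < 22 * n
  · rw [N_c21 (by omega) (by omega)]
    have hc := cell_minors' hn hj1 hj7 h13 (cover_a (by omega) hb22 hp2) (A := -4) (B := -1) (fun odd => by have h := (check_a odd).1; push_cast at h; exact h) 0 (-1) le_rfl
      (by norm_num) (by norm_num) le_rfl
    exact ⟨fun hne => by linarith [hc.1 hne], fun hne => by linarith [hc.2 hne]⟩
  have h44 : 44 * n < 2 * p := by omega
  by_cases h' : 2 * p ≤ 46 * n
  · rw [N_c22 h44 h']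
    have hc := cell_minors' hn hj1 hj7 h13 (cover_c22 h44 h' hp2) checkM_c22 0 0 le_rfl (by norm_num) le_rfl le_rfl
    exact ⟨fun hne => by linarith [hc.1 hne], fun hne => by linarith [hc.2 hne]⟩
  by_cases h : 2 * p ≤ 50 * n
  · rw [N_c23 (by omega) h]
    have hc := cell_minors' hn hj1 hj7 h13 (cover_c23 (by omega) h hp2) checkM_c23 0 0 le_rfl (by norm_num) le_rfl (by norm_num)
    exact ⟨fun hne => by linarith [hc.1 hne], fun hne => by linarith [hc.2 hne]⟩
  by_cases h' : 2 * p ≤ 52 * n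
  · rw [N_c25 (by omega) h']
    have hc := cell_minors' hn hj1 hj7 h13 (cover_c25 (by omega) h' hp2) checkM_c25 0 0 le_rfl (by norm_num) le_rfl (by norm_num)
    exact ⟨fun hne => by linarith [hc.1 hne], fun hne => by linarith [hc.2 hne]⟩
  · rw [N_c26 (by omega) (by omega)]
    have hc := cell_minors' hn hj1 hj7 h13 (cover_c26 (by omega) (by omega) hp2) checkM_c26 0 0 le_rfl (by norm_num) le_rfl (by norm_num)
    exact ⟨fun hne => by linarith [minorQ_c26 hn hj1 hj7 hprime (by omega) h35 hne], fun hne => by linarith [hc.2 hne]⟩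

end Ray

end Summit.KontsevichZagierPeriods.Zeta5Search.StairFLAG
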